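import Mathlib
import Summits.ResolutionOfSingularities.ResolutionOfSingularities.Theorems.WeightedInvariantLocalWeightedDropWildMonicKangarooForms

/-!
# `WeightedInvariant.LocalWeightedDrop`, line `hasse-ridge-face-selection`, S3ρ sub-stub S3ρD₂ `stub_wildMonicSurfaceDescent₂`:
# CASE D-d (KANGAROO), part 5 — INITIAL FORMS OF THE RE-CENTRED SLOTS (Perlega's Lemma 5.1.1 (2) / Lemma 5.1.2 at the level of forms)

Crux item stmt-ResolutionOfSingularities-8899 `LocalWeightedDrop` (route `ResolutionOfSingularities/WeightedInvariant`), engine of the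
door `HypersurfaceCentreConstruction` stmt-ResolutionOfSingularities-19897.  [OURS · L1 W4.3, chain w43, seat res-type-056 on ROADMAP item
(C8) = D-d KANGAROO of `L/res-L1-w43-stub-7/S3RHOD-ROADMAP.md`.  MODEL: S. Perlega, thesis Wien 2017 / arXiv:2011.14443, Ch. 5 §1
[cite: Perlega2020, Lemma 5.1.1 (2) (proof: «`w(Σ_{k>i} C(k,i) f_k g^{k−i}) > w(f_i)`, hence `w(f̃_i) = w(f_i)`»), Lemma 5.1.2 (clean_lemma)
(i) «`in_w(f̃_i) = in_w(f_i)`», (ii)/(iii) «`in_w(f̃_{c−q}) = [in_w(f_{c−q}) +] C(c,q)·in_w(f_c)·in_w(g)^q`»] and the `ỹ`-valuation form of the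
same computations used in Ch. 6 Prop. 6.2.3.  Nothing here is a statement of H. Hironaka's manuscript [claim: Hironaka2017, status:
under-review]; OUR lemmas on stub-7's ORDER-level slot analysis (`…WildMonicShiftOrder[Cases]`: `shift_eq`, `slotWeight_mul_lt_term`,
`slotWeight_mul_weightedOrder_top_eq`, `shift_top_eq_zero_of_gt`) lifted to the FORMS `WildMonic.inW` through the sum rule of
`…WildMonicKangarooForms`.]

For a tuple `B` with `m = wMin w B < ⊤`, a re-centring `g` with `d!·ord_w g ≥ m`, and `B̃ = shift d B g` (`B̃_i = C(d,i) g^{d−i} + Σ_j C(j,i) B_j g^{j−i}`):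
* `inW_shift_eq_of_kept` — THE KEPT SLOT (Lemma 5.1.2 (i) / Lemma 5.1.1 (2)): if slot `i` attains `m`, every later slot has `s_j > m` or
  `d!·ord_w g > m`, and the top coefficient has scaled order `> m`, then `in_w(B̃_i) = in_w(B_i)` (and the slot still attains `m`);
* `inW_shift_slot_sub_qOf` — THE SLOT `d − q` WHEN `d!·ord_w g = m` AND NO SLOT ABOVE IT ATTAINS (Lemma 5.1.2 (ii)/(iii)): `in_w(B̃_{d−q})`
  is the sum `H` of the weight component of `B_{d−q}` (its initial form if the slot attains, else `0`) and `C(d,q)·in_w(g)^q`, PROVIDED `H ≠ 0`,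
  and then the slot attains `m`;
* `slot_attains_and_yOrd_eq_of_yMin` — THE `ỹ`-MINIMAL SLOT (the valuation form of Lemma 5.1.1 (2) for `ỹ = (w, ord_{(y)} ∘ in_w)`): when
  `d!·ord_w g = m`, an attaining slot `i` whose initial form has `s_i·ord_{(y)} in_w(B_i) = D` keeps a form of `y`-order exactly `D/s_i` after
  re-centring as soon as every later attaining slot has `s_j·ord_{(y)} in_w(B_j) ≥ D` and `d!·ord_{(y)} in_w(g) > D` (the lower-order term
  survives: every other weight-`m` contribution has strictly larger `y`-order by stub-7's `slotWeight_mul_lt_term` read with the weight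
  `Pi.single y 1` on the forms).
AI-written; gate-accepted means sorry-free with standard axioms, not refereed.
-/

set_option linter.dupNamespace false -- mandated namespace of this single-conjunct summit

noncomputable section

namespace Summit.ResolutionOfSingularities.ResolutionOfSingularities.Theorems

namespace WildMonic

open MvPowerSeries MonicDescent

variable {k : Type} [Field k] (w : Fin 2 → ℕ) {d : ℕ} (B : Fin d → MvPowerSeries (Fin 2) k) (g : MvPowerSeries (Fin 2) k)

/-! ## Small helpers -/

/-- Cancelling the slot weight in a non-strict inequality. -/
theorem le_of_slotWeight_mul_le (i : Fin d) {a b : ℕ∞} (h : (slotWeight d i : ℕ∞) * a ≤ (slotWeight d i : ℕ∞) * b) : a ≤ b :=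
  (ENat.mul_le_mul_left_iff (by exact_mod_cast (slotWeight_pos i).ne') (ENat.coe_ne_top _)).mp h

/-- Cancelling the slot weight in an equality. -/
theorem eq_of_slotWeight_mul_eq (i : Fin d) {a b : ℕ∞} (h : (slotWeight d i : ℕ∞) * a = (slotWeight d i : ℕ∞) * b) : a = b :=
  le_antisymm (le_of_slotWeight_mul_le i h.le) (le_of_slotWeight_mul_le i h.ge)

/-- An attaining slot of a tuple with finite `m` is non-zero, and its weighted order `V` satisfies `s_i · V = m`. -/
theorem exists_weightedOrder_eq_of_attains {i : Fin d} (hi : slotWOrd w B i = wMin w B) (hm : wMin w B ≠ ⊤) :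
    B i ≠ 0 ∧ ∃ V : ℕ, (B i).weightedOrder w = V ∧ (slotWeight d i : ℕ∞) * V = wMin w B := by
  have hfin : (B i).weightedOrder w ≠ ⊤ := weightedOrder_ne_top_of_slotWOrd_ne_top w B (by rw [hi]; exact hm)
  refine ⟨(weightedOrder_eq_top_iff w).not.mp hfin, ((B i).weightedOrder w).toNat, (ENat.coe_toNat hfin).symm, ?_⟩
  rw [ENat.coe_toNat hfin, ← hi]; rfl

/-- If `d!·ord_w g = m < ⊤` then `g ≠ 0`. -/
theorem ne_zero_of_factorial_mul_eq (hm : wMin w B ≠ ⊤) (heq : wMin w B = (d.factorial : ℕ∞) * g.weightedOrder w) : g ≠ 0 := by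
  intro h
  rw [h, weightedOrder_zero, ENat.mul_top (by exact_mod_cast (Nat.factorial_pos d).ne')] at heq
  exact hm heq

/-! ## The kept slot -/

/-- The weight-`V` components of the terms `C(j,i) B_j g^{j−i}`, `j ≠ i`, of `B̃_i` vanish when slot `i` attains `m = s_i V` and the later slots
are strict (`s_j > m` or `d! ord_w g > m`). -/
theorem component_shift_term_eq_zero {i : Fin d} (hm : wMin w B ≠ ⊤) (hG : wMin w B ≤ (d.factorial : ℕ∞) * g.weightedOrder w)
    (hlater : ∀ j : Fin d, (i : ℕ) < j → wMin w B < slotWOrd w B j ∨ wMin w B < (d.factorial : ℕ∞) * g.weightedOrder w)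
    {V : ℕ} (hV : (slotWeight d i : ℕ∞) * V = wMin w B) {j : Fin d} (hj : j ≠ i) :
    (V : ℕ∞) ≤ ((((j : ℕ).choose i : ℕ) : MvPowerSeries (Fin 2) k) * B j * g ^ ((j : ℕ) - i)).weightedOrder w ∧
      weightedHomogeneousComponent w V ((((j : ℕ).choose i : ℕ) : MvPowerSeries (Fin 2) k) * B j * g ^ ((j : ℕ) - i)) = 0 := by
  rcases lt_or_gt_of_ne (Fin.val_injective.ne hj) with hlt | hgt
  · rw [shift_term_of_lt B g hlt, weightedOrder_zero, map_zero]; exact ⟨le_top, rfl⟩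
  · have h : (V : ℕ∞) < ((((j : ℕ).choose i : ℕ) : MvPowerSeries (Fin 2) k) * B j * g ^ ((j : ℕ) - i)).weightedOrder w := by
      refine lt_of_slotWeight_mul_lt i ?_
      rw [hV]
      exact slotWeight_mul_lt_term w B g hgt hm (wMin_le_slotWOrd w B j) hG (hlater j hgt)
    exact ⟨h.le, component_eq_zero_of_lt w h⟩

/-- THE KEPT SLOT AT THE LEVEL OF FORMS (Perlega Lemma 5.1.2 (i); Lemma 5.1.1 (2)): if slot `i` attains `m < ⊤`, `d!·ord_w g ≥ m`, every later
slot `j > i` has `s_j > m` or `d!·ord_w g > m`, and the top coefficient `C(d,i) g^{d−i}` has scaled order `> m`, then the slot `i` of the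
re-centred tuple has the SAME INITIAL FORM: `in_w(B̃_i) = in_w(B_i)` (and still attains `m`). -/
theorem inW_shift_eq_of_kept (i : Fin d) (hi : slotWOrd w B i = wMin w B) (hm : wMin w B ≠ ⊤)
    (hG : wMin w B ≤ (d.factorial : ℕ∞) * g.weightedOrder w)
    (hlater : ∀ j : Fin d, (i : ℕ) < j → wMin w B < slotWOrd w B j ∨ wMin w B < (d.factorial : ℕ∞) * g.weightedOrder w)
    (htop : wMin w B < (slotWeight d i : ℕ∞) * (((d.choose i : ℕ) : MvPowerSeries (Fin 2) k) * g ^ (d - (i : ℕ))).weightedOrder w) :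
    slotWOrd w (shift d B g) i = wMin w B ∧ inW w (shift d B g i) = inW w (B i) := by
  classical
  obtain ⟨hBi, V, hVi, hV⟩ := exists_weightedOrder_eq_of_attains w B hi hm
  -- the finite sum of the lower terms
  have hsum_le : ∀ j ∈ (Finset.univ : Finset (Fin d)),
      (V : ℕ∞) ≤ ((((j : ℕ).choose i : ℕ) : MvPowerSeries (Fin 2) k) * B j * g ^ ((j : ℕ) - i)).weightedOrder w := by
    intro j _
    by_cases hj : j = i
    · subst hj; rw [shift_term_self B g, hVi]
    · exact (component_shift_term_eq_zero w B g hm hG hlater hV hj).1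
  have hcomp : ∑ j : Fin d, weightedHomogeneousComponent w V ((((j : ℕ).choose i : ℕ) : MvPowerSeries (Fin 2) k) * B j * g ^ ((j : ℕ) - i)) =
      inW w (B i) := by
    rw [Finset.sum_eq_single i]
    · rw [shift_term_self B g, component_eq_inW_of_eq w hVi]
    · intro j _ hj; exact (component_shift_term_eq_zero w B g hm hG hlater hV hj).2
    · intro h; exact absurd (Finset.mem_univ i) h
  have hne : inW w (B i) ≠ 0 := inW_ne_zero w hBi
  have hS_ord := weightedOrder_sum_eq_of_component_ne_zero w Finset.univ
    (fun j : Fin d => (((j : ℕ).choose i : ℕ) : MvPowerSeries (Fin 2) k) * B j * g ^ ((j : ℕ) - i)) hsum_le (by rw [hcomp]; exact hne)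
  have hS_in := inW_sum_eq_of_component_ne_zero w Finset.univ
    (fun j : Fin d => (((j : ℕ).choose i : ℕ) : MvPowerSeries (Fin 2) k) * B j * g ^ ((j : ℕ) - i)) hsum_le (by rw [hcomp]; exact hne)
  rw [hcomp] at hS_in
  -- add the top term, of order `> V`
  have htop' : (V : ℕ∞) < (((d.choose i : ℕ) : MvPowerSeries (Fin 2) k) * g ^ (d - (i : ℕ))).weightedOrder w :=
    lt_of_slotWeight_mul_lt i (by rw [hV]; exact htop)
  obtain ⟨hord, hin⟩ := inW_add_eq_of_lt w hS_ord htop'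
  have hshift : shift d B g i = (∑ j : Fin d, (((j : ℕ).choose i : ℕ) : MvPowerSeries (Fin 2) k) * B j * g ^ ((j : ℕ) - i)) +
      ((d.choose i : ℕ) : MvPowerSeries (Fin 2) k) * g ^ (d - (i : ℕ)) := by rw [shift_eq, add_comm]
  refine ⟨?_, ?_⟩
  · unfold slotWOrd; rw [hshift, hord, hV]
  · rw [hshift, hin, hS_in]

/-! ## The slot `d − q` when `d!·ord_w g = m` -/

section SlotSubQOf

variable (p : ℕ) [Fact p.Prime] [CharP k p]

/-- THE SLOT `d − q` AT THE LEVEL OF FORMS (Perlega Lemma 5.1.2 (ii)/(iii)): if `d!·ord_w g = m < ⊤` and no slot ABOVE `d − q` attains `m`, then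
the weight-`m/s_{d−q}` component of `B̃_{d−q}` is `H = (weight component of B_{d−q}) + C(d,q)·in_w(g)^q`; if `H ≠ 0` the slot attains `m` after
re-centring and `in_w(B̃_{d−q}) = H`.  (The component of `B_{d−q}` is `in_w(B_{d−q})` if that slot attains — case (iii) — and `0` otherwise —
case (ii), `component_eq_inW_of_eq` / `component_eq_zero_of_lt`.) -/
theorem inW_shift_slot_sub_qOf {i : Fin d} (hi : (i : ℕ) = d - qOf p d) (hm : wMin w B ≠ ⊤)
    (heq : wMin w B = (d.factorial : ℕ∞) * g.weightedOrder w)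
    (hlater : ∀ j : Fin d, d - qOf p d < (j : ℕ) → wMin w B < slotWOrd w B j)
    {V : ℕ} (hV : (slotWeight d i : ℕ∞) * V = wMin w B)
    (hH : weightedHomogeneousComponent w V (B i) + C ((d.choose i : ℕ) : k) * (inW w g) ^ (d - (i : ℕ)) ≠ 0) :
    slotWOrd w (shift d B g) i = wMin w B ∧
      inW w (shift d B g i) = weightedHomogeneousComponent w V (B i) + C ((d.choose i : ℕ) : k) * (inW w g) ^ (d - (i : ℕ)) := by
  classical
  have hd : 0 < d := Fin.pos i
  have hg : g ≠ 0 := ne_zero_of_factorial_mul_eq w B g hm heq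
  have hG : wMin w B ≤ (d.factorial : ℕ∞) * g.weightedOrder w := heq.le
  have hlater' : ∀ j : Fin d, (i : ℕ) < j → wMin w B < slotWOrd w B j ∨ wMin w B < (d.factorial : ℕ∞) * g.weightedOrder w :=
    fun j hj => Or.inl (hlater j (by omega))
  -- the top term: order exactly `V`, component `C(d,q) in_w(g)^q`
  have hq : d - (i : ℕ) = qOf p d := by have := Nat.le_of_dvd hd (qOf_dvd p d); omega
  have hcne : ((d.choose i : ℕ) : k) ≠ 0 := by
    rw [← Nat.choose_symm i.2.le, hq]; exact natCast_choose_qOf_ne_zero (k := k) p hd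
  have htop_ord : (((d.choose i : ℕ) : MvPowerSeries (Fin 2) k) * g ^ (d - (i : ℕ))).weightedOrder w = V := by
    apply eq_of_slotWeight_mul_eq i
    rw [slotWeight_mul_weightedOrder_top_eq (k := k) w g p hi, hV, heq]
  have htop_in : weightedHomogeneousComponent w V (((d.choose i : ℕ) : MvPowerSeries (Fin 2) k) * g ^ (d - (i : ℕ))) =
      C ((d.choose i : ℕ) : k) * (inW w g) ^ (d - (i : ℕ)) := by
    rw [component_eq_inW_of_eq w htop_ord, ← map_natCast (C : k →+* MvPowerSeries (Fin 2) k), inW_C_mul w hcne (pow_ne_zero _ hg),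
      inW_pow w hg]
  -- the lower terms: component of `B_i` at `j = i`, zero elsewhere
  have hVi : (V : ℕ∞) ≤ (B i).weightedOrder w := le_of_slotWeight_mul_le i (by rw [hV]; exact wMin_le_slotWOrd w B i)
  have hsum_le : ∀ j ∈ (Finset.univ : Finset (Fin d)),
      (V : ℕ∞) ≤ ((((j : ℕ).choose i : ℕ) : MvPowerSeries (Fin 2) k) * B j * g ^ ((j : ℕ) - i)).weightedOrder w := by
    intro j _
    by_cases hj : j = i
    · subst hj; rw [shift_term_self B g]; exact hVi
    · exact (component_shift_term_eq_zero w B g hm hG hlater' hV hj).1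
  have hcomp : ∑ j : Fin d, weightedHomogeneousComponent w V ((((j : ℕ).choose i : ℕ) : MvPowerSeries (Fin 2) k) * B j * g ^ ((j : ℕ) - i)) =
      weightedHomogeneousComponent w V (B i) := by
    rw [Finset.sum_eq_single i]
    · rw [shift_term_self B g]
    · intro j _ hj; exact (component_shift_term_eq_zero w B g hm hG hlater' hV hj).2
    · intro h; exact absurd (Finset.mem_univ i) h
  -- the two-block sum rule on `![lower sum, top]`
  set S := ∑ j : Fin d, (((j : ℕ).choose i : ℕ) : MvPowerSeries (Fin 2) k) * B j * g ^ ((j : ℕ) - i) with hSdef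
  set T := ((d.choose i : ℕ) : MvPowerSeries (Fin 2) k) * g ^ (d - (i : ℕ)) with hTdef
  have hS_le : (V : ℕ∞) ≤ S.weightedOrder w := le_weightedOrder_sum_of_le w _ _ hsum_le
  have hS_comp : weightedHomogeneousComponent w V S = weightedHomogeneousComponent w V (B i) := by rw [hSdef, map_sum, hcomp]
  have hpair_le : ∀ l ∈ (Finset.univ : Finset (Fin 2)), (V : ℕ∞) ≤ ((![S, T] : Fin 2 → MvPowerSeries (Fin 2) k) l).weightedOrder w := by
    intro l _; fin_cases l
    · exact hS_le
    · simp only [Fin.mk_one, Matrix.cons_val_one, Matrix.cons_val_zero]; rw [htop_ord]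
  have hpair_comp : ∑ l : Fin 2, weightedHomogeneousComponent w V ((![S, T] : Fin 2 → MvPowerSeries (Fin 2) k) l) =
      weightedHomogeneousComponent w V (B i) + C ((d.choose i : ℕ) : k) * (inW w g) ^ (d - (i : ℕ)) := by
    rw [Fin.sum_univ_two, Matrix.cons_val_zero, Matrix.cons_val_one, Matrix.cons_val_zero, hS_comp, htop_in]
  have hsum2 : ∑ l : Fin 2, (![S, T] : Fin 2 → MvPowerSeries (Fin 2) k) l = shift d B g i := by
    rw [Fin.sum_univ_two, Matrix.cons_val_zero, Matrix.cons_val_one, Matrix.cons_val_zero, shift_eq, add_comm]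
  have hord := weightedOrder_sum_eq_of_component_ne_zero w Finset.univ (![S, T] : Fin 2 → MvPowerSeries (Fin 2) k) hpair_le
    (by rw [hpair_comp]; exact hH)
  have hin := inW_sum_eq_of_component_ne_zero w Finset.univ (![S, T] : Fin 2 → MvPowerSeries (Fin 2) k) hpair_le
    (by rw [hpair_comp]; exact hH)
  rw [hsum2] at hord hin
  refine ⟨?_, by rw [hin, hpair_comp]⟩
  unfold slotWOrd; rw [hord, hV]

end SlotSubQOf

/-! ## The `ỹ`-minimal attaining slot when `d!·ord_w g = m` -/

section YMin

variable (y : Fin 2)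

/-- In the equality case `d!·ord_w g = m`, the weight-`V` component of a term `C(j,i) B_j g^{j−i}` with `j > i` is either `0` or the form
`C(j,i)·in_w(B_j)·in_w(g)^{j−i}` of an ATTAINING slot `j` with `C(j,i) ≠ 0`. -/
theorem component_shift_term_eq_or {i j : Fin d} (hij : (i : ℕ) < j) (hm : wMin w B ≠ ⊤)
    (heq : wMin w B = (d.factorial : ℕ∞) * g.weightedOrder w) {V : ℕ} (hV : (slotWeight d i : ℕ∞) * V = wMin w B) :
    weightedHomogeneousComponent w V ((((j : ℕ).choose i : ℕ) : MvPowerSeries (Fin 2) k) * B j * g ^ ((j : ℕ) - i)) = 0 ∨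
      (slotWOrd w B j = wMin w B ∧ (((j : ℕ).choose i : ℕ) : k) ≠ 0 ∧
        weightedHomogeneousComponent w V ((((j : ℕ).choose i : ℕ) : MvPowerSeries (Fin 2) k) * B j * g ^ ((j : ℕ) - i)) =
          C ((((j : ℕ).choose i : ℕ) : k)) * inW w (B j) * (inW w g) ^ ((j : ℕ) - i)) := by
  have hg : g ≠ 0 := ne_zero_of_factorial_mul_eq w B g hm heq
  by_cases hc : (((j : ℕ).choose i : ℕ) : k) = 0
  · left
    rw [← map_natCast (C : k →+* MvPowerSeries (Fin 2) k), hc, map_zero, zero_mul, zero_mul, map_zero]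
  by_cases hj : slotWOrd w B j = wMin w B
  · right
    obtain ⟨hBj, Vj, hVj, hVj'⟩ := exists_weightedOrder_eq_of_attains w B hj hm
    refine ⟨hj, hc, ?_⟩
    -- the order of the term is exactly `V`
    have hterm_ord : ((((j : ℕ).choose i : ℕ) : MvPowerSeries (Fin 2) k) * B j * g ^ ((j : ℕ) - i)).weightedOrder w = V := by
      apply eq_of_slotWeight_mul_eq i
      have h1 := slot_term_identity w B g i j
      rw [← map_natCast (C : k →+* MvPowerSeries (Fin 2) k), mul_assoc, weightedOrder_C_mul_of_ne_zero w hc, hV]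
      -- `(d−i)·s_i·ord(B_j g^{j−i}) = (d−j) s_j + (j−i) G` with `s_j = m = G`; and `(d−i)·m = (d−j)m + (j−i)m`
      apply le_antisymm
      · apply le_of_sub_mul_le i
        rw [h1, hj, ← heq]
        have : ((d - (i : ℕ) : ℕ) : ℕ∞) = ((d - (j : ℕ) : ℕ) : ℕ∞) + (((j : ℕ) - i : ℕ) : ℕ∞) := by
          rw [← Nat.cast_add]; congr 1; have := j.2; omega
        rw [this, add_mul]
      · apply le_of_sub_mul_le i
        rw [h1, hj, ← heq]
        have : ((d - (i : ℕ) : ℕ) : ℕ∞) = ((d - (j : ℕ) : ℕ) : ℕ∞) + (((j : ℕ) - i : ℕ) : ℕ∞) := by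
          rw [← Nat.cast_add]; congr 1; have := j.2; omega
        rw [this, add_mul]
    rw [component_eq_inW_of_eq w hterm_ord, ← map_natCast (C : k →+* MvPowerSeries (Fin 2) k), mul_assoc,
      inW_C_mul w hc (mul_ne_zero hBj (pow_ne_zero _ hg)), inW_mul w hBj (pow_ne_zero _ hg), inW_pow w hg, mul_assoc]
  · left
    apply component_eq_zero_of_lt w
    refine lt_of_slotWeight_mul_lt i ?_
    rw [hV]
    exact slotWeight_mul_lt_term w B g hij hm (wMin_le_slotWOrd w B j) heq.le
      (Or.inl (lt_of_le_of_ne (wMin_le_slotWOrd w B j) (Ne.symm hj)))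

/-- THE `ỹ`-MINIMAL ATTAINING SLOT (valuation form of Lemma 5.1.1 (2) for `ỹ = (w, ord_{(y)} ∘ in_w)`): when `d!·ord_w g = m < ⊤`, an attaining slot
`i` with `D = s_i · ord_{(y)} in_w(B_i)` such that every LATER attaining slot has `s_j · ord_{(y)} in_w(B_j) ≥ D` and `d! · ord_{(y)} in_w(g) > D`
still attains `m` after re-centring, with `s_i · ord_{(y)} in_w(B̃_i) = D`: among the weight-`m` contributions to `B̃_i` the form `in_w(B_i)`
has strictly the least `y`-order. -/
theorem slot_attains_and_yOrd_eq_of_yMin (i : Fin d) (hi : slotWOrd w B i = wMin w B) (hm : wMin w B ≠ ⊤)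
    (heq : wMin w B = (d.factorial : ℕ∞) * g.weightedOrder w)
    (hslots : ∀ j : Fin d, (i : ℕ) < j → slotWOrd w B j = wMin w B →
      (slotWeight d i : ℕ∞) * (inW w (B i)).weightedOrder (Pi.single y 1) ≤
        (slotWeight d j : ℕ∞) * (inW w (B j)).weightedOrder (Pi.single y 1))
    (hgy : (slotWeight d i : ℕ∞) * (inW w (B i)).weightedOrder (Pi.single y 1) <
      (d.factorial : ℕ∞) * (inW w g).weightedOrder (Pi.single y 1)) :
    slotWOrd w (shift d B g) i = wMin w B ∧
      (inW w (shift d B g i)).weightedOrder (Pi.single y 1) = (inW w (B i)).weightedOrder (Pi.single y 1) := by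
  classical
  obtain ⟨hBi, V, hVi, hV⟩ := exists_weightedOrder_eq_of_attains w B hi hm
  have hg : g ≠ 0 := ne_zero_of_factorial_mul_eq w B g hm heq
  have hG : wMin w B ≤ (d.factorial : ℕ∞) * g.weightedOrder w := heq.le
  set D := (slotWeight d i : ℕ∞) * (inW w (B i)).weightedOrder (Pi.single y 1) with hDdef
  have hinBi : inW w (B i) ≠ 0 := inW_ne_zero w hBi
  have hDfin : D ≠ ⊤ := natCast_mul_ne_top _ ((weightedOrder_eq_top_iff _).not.mpr hinBi)
  -- the family of weight-`V` components, indexed by `Option (Fin d)` (`none` = the top term)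
  set cmp : Option (Fin d) → MvPowerSeries (Fin 2) k := fun o => Option.elim o
      (weightedHomogeneousComponent w V (((d.choose i : ℕ) : MvPowerSeries (Fin 2) k) * g ^ (d - (i : ℕ))))
      (fun j => weightedHomogeneousComponent w V ((((j : ℕ).choose i : ℕ) : MvPowerSeries (Fin 2) k) * B j * g ^ ((j : ℕ) - i)))
    with hcmp
  -- every component other than `j = i` is `0` or has `y`-order `> ord_y in_w(B_i)`
  have hothers : ∀ o : Option (Fin d), o ≠ some i →
      cmp o = 0 ∨ (inW w (B i)).weightedOrder (Pi.single y 1) < (cmp o).weightedOrder (Pi.single y 1) := by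
    intro o ho
    rcases o with _ | j
    · -- the top term
      by_cases hc : ((d.choose i : ℕ) : k) = 0
      · left; simp only [hcmp, Option.elim]
        rw [← map_natCast (C : k →+* MvPowerSeries (Fin 2) k), hc, map_zero, zero_mul, map_zero]
      · right; simp only [hcmp, Option.elim]
        have htop_ord : (((d.choose i : ℕ) : MvPowerSeries (Fin 2) k) * g ^ (d - (i : ℕ))).weightedOrder w = V := by
          apply eq_of_slotWeight_mul_eq i
          rw [hV, heq, ← map_natCast (C : k →+* MvPowerSeries (Fin 2) k), weightedOrder_C_mul_of_ne_zero w hc, weightedOrder_pow_eq,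
            ← mul_assoc, ← Nat.cast_mul, mul_comm (slotWeight d i), sub_mul_slotWeight]
        rw [component_eq_inW_of_eq w htop_ord, ← map_natCast (C : k →+* MvPowerSeries (Fin 2) k), inW_C_mul w hc (pow_ne_zero _ hg),
          inW_pow w hg, weightedOrder_C_mul_of_ne_zero _ hc, weightedOrder_pow_eq]
        refine lt_of_slotWeight_mul_lt i ?_
        calc (slotWeight d i : ℕ∞) * (inW w (B i)).weightedOrder (Pi.single y 1) = D := rfl
          _ < (d.factorial : ℕ∞) * (inW w g).weightedOrder (Pi.single y 1) := hgy
          _ = (slotWeight d i : ℕ∞) * (((d - (i : ℕ) : ℕ) : ℕ∞) * (inW w g).weightedOrder (Pi.single y 1)) := by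
              rw [← mul_assoc, ← Nat.cast_mul, mul_comm (slotWeight d i), sub_mul_slotWeight]
    · have hji : j ≠ i := fun h => ho (by rw [h])
      rcases lt_or_gt_of_ne (Fin.val_injective.ne hji) with hlt | hgt
      · left; simp only [hcmp, Option.elim]; rw [shift_term_of_lt B g hlt, map_zero]
      · rcases component_shift_term_eq_or w B g hgt hm heq hV with h0 | ⟨hj, hc, hform⟩
        · left; simpa only [hcmp, Option.elim] using h0
        · right; simp only [hcmp, Option.elim]; rw [hform]
          obtain ⟨hBj, -, -, -⟩ := exists_weightedOrder_eq_of_attains w B hj hm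
          refine lt_of_slotWeight_mul_lt i ?_
          -- stub-7's strict term bound, read with the weight `Pi.single y 1` on the FORMS
          have key := slotWeight_mul_lt_term (Pi.single y 1) (fun j => inW w (B j)) (inW w g) hgt hDfin
            (by show D ≤ slotWOrd (Pi.single y 1) (fun j => inW w (B j)) j; exact hslots j hgt hj) hgy.le (Or.inr hgy)
          exact key
  -- the `j = i` component is `in_w(B_i)`
  have hself : cmp (some i) = inW w (B i) := by
    simp only [hcmp, Option.elim]; rw [shift_term_self B g, component_eq_inW_of_eq w hVi]
  -- `y`-order of the total component
  have hsum_cmp : ∑ o : Option (Fin d), cmp o = weightedHomogeneousComponent w V (shift d B g i) := by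
    rw [Fintype.sum_option, shift_eq, map_add, map_sum]
    rfl
  have hy : (∑ o : Option (Fin d), cmp o).weightedOrder (Pi.single y 1) = (inW w (B i)).weightedOrder (Pi.single y 1) := by
    rw [← hself]
    refine weightedOrder_finset_sum_eq_of_lt (Pi.single y 1) Finset.univ cmp (Finset.mem_univ _) fun o _ ho => ?_
    rw [hself]
    rcases hothers o ho with h0 | hlt
    · rw [h0, weightedOrder_zero]; exact lt_top_iff_ne_top.mpr ((weightedOrder_eq_top_iff _).not.mpr hinBi)
    · exact hlt
  have hne : weightedHomogeneousComponent w V (shift d B g i) ≠ 0 := by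
    rw [← hsum_cmp]; intro h0
    rw [h0, weightedOrder_zero] at hy
    exact ((weightedOrder_eq_top_iff _).not.mpr hinBi) hy.symm
  -- order of `B̃_i` is `V`: all terms have order `≥ V` and the component is non-zero
  have hall : (V : ℕ∞) ≤ (shift d B g i).weightedOrder w :=
    le_of_slotWeight_mul_le i (by rw [hV]; exact wMin_le_slotWOrd_shift w B g hG i)
  have hordV : (shift d B g i).weightedOrder w = V := by
    refine le_antisymm ?_ hall
    by_contra hlt
    exact hne (component_eq_zero_of_lt w (not_le.mp hlt))
  refine ⟨by unfold slotWOrd; rw [hordV, hV], ?_⟩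
  rw [inW_eq_component w hordV, ← hsum_cmp, hy]

end YMin

end WildMonic

end Summit.ResolutionOfSingularities.ResolutionOfSingularities.Theorems

end
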